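import Summits.Ventures.HodgeRepro2.T5SplitPlaceLocalDegree
import Summits.Ventures.HodgeRepro2.T5QuadraticPlaceTrichotomy

/-!
# T5QuadraticLocalPicture — the complete local picture of a finite place in a quadratic extension:
split (`L_w = L_{w'} = K_v`), inert (`[L_w : K_v] = 2`, `e = 1`, `f = 2`) or ramified
(`[L_w : K_v] = 2`, `e = 2`, `f = 1`)

Tier-5 kernel support (N3) — p8, gen 15.  §8(d): uses an L-value-free non-vanishing device: NO.

`T5QuadraticPlaceTrichotomy` sorted the finite places of `K` in a quadratic `L / K` into split /
inert / ramified; `T5SplitPlaceLocalDegree` and `T5InertGlobalToLocal` attach the local degrees.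
`quadratic_local_picture` states all of it at once — the record's «`E ⊗_F F_v = F_v × F_v`, or
`E_v / F_v` unramified quadratic, or `E_v / F_v` ramified quadratic».

Nothing here identifies which places of the datum fall in which class.
-/

namespace Summit.Ventures.HodgeRepro2.T5QuadraticLocalPicture

open IsDedekindDomain HeightOneSpectrum NumberField

variable {K : Type*} [Field K] [NumberField K] (v : HeightOneSpectrum (RingOfIntegers K))
variable {L : Type*} [Field L] [NumberField L] [Algebra K L]

/-- THE LOCAL PICTURE of a finite place `v` of `K` in a quadratic `L / K`:
SPLIT — two distinct places `w ≠ w'` of `L` over `v`, both with `K_v → L_w` bijective;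
INERT — a unique place `w` over `v` with `e = 1`, `f = 2`, `[L_w : K_v] = 2`;
RAMIFIED — a unique place `w` over `v` with `e = 2`, `f = 1`, `[L_w : K_v] = 2`. -/
theorem quadratic_local_picture (h2 : Module.finrank K L = 2) :
    (∃ w w' : HeightOneSpectrum (𝓞 L), w ≠ w' ∧
      ∃ (_ : w.asIdeal.LiesOver v.asIdeal) (_ : w'.asIdeal.LiesOver v.asIdeal),
        Function.Bijective (algebraMap (v.adicCompletion K) (w.adicCompletion L)) ∧
        Function.Bijective (algebraMap (v.adicCompletion K) (w'.adicCompletion L))) ∨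
    (∃ w : HeightOneSpectrum (𝓞 L), ∃ _ : w.asIdeal.LiesOver v.asIdeal,
      (∀ w' : HeightOneSpectrum (𝓞 L), w'.asIdeal.LiesOver v.asIdeal → w' = w) ∧
      v.asIdeal.ramificationIdx' w.asIdeal = 1 ∧ v.asIdeal.inertiaDeg' w.asIdeal = 2 ∧
      Module.finrank (v.adicCompletion K) (w.adicCompletion L) = 2) ∨
    (∃ w : HeightOneSpectrum (𝓞 L), ∃ _ : w.asIdeal.LiesOver v.asIdeal,
      (∀ w' : HeightOneSpectrum (𝓞 L), w'.asIdeal.LiesOver v.asIdeal → w' = w) ∧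
      v.asIdeal.ramificationIdx' w.asIdeal = 2 ∧ v.asIdeal.inertiaDeg' w.asIdeal = 1 ∧
      Module.finrank (v.adicCompletion K) (w.adicCompletion L) = 2) := by
  rcases T5QuadraticPlaceTrichotomy.quadratic_place_trichotomy v h2 with
    ⟨w, w', hne, hw, hw'⟩ | ⟨w, hw, huniq, he, hf⟩ | ⟨w, hw, huniq, he, hf⟩
  · left
    haveI := hw
    haveI := hw'
    exact ⟨w, w', hne, hw, hw',
      T5SplitPlaceLocalDegree.bijective_algebraMap_adicCompletion_of_ne v w w' h2 hne,
      T5SplitPlaceLocalDegree.bijective_algebraMap_adicCompletion_of_ne v w' w h2 hne.symm⟩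
  · right; left
    haveI := hw
    exact ⟨w, hw, huniq, he, hf,
      T5InertGlobalToLocal.finrank_adicCompletion_eq_two_of_inert v w he hf⟩
  · right; right
    haveI := hw
    refine ⟨w, hw, huniq, he, hf, ?_⟩
    rw [T5InertGlobalToLocal.finrank_adicCompletion_eq_mul v w, he, hf]

end Summit.Ventures.HodgeRepro2.T5QuadraticLocalPicture
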